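import Summits.BirchSwinnertonDyer.BirchSwinnertonDyer.Theorems.ThetaPartnerAtTwoSignedKatoUpToAtTwoLocalTwoTower
import Literature.NumberTheory.EllipticCurves.EichlerShimuraCongruenceHondaProofs
import Literature.NumberTheory.EllipticCurves.SerreOpenImageOrdinaryInertiaProofs
import Literature.NumberTheory.EllipticCurves.Rank1Residual.Predicates
import Summits.BirchSwinnertonDyer.Rank1Residual.Additive.GoodSupersingularPadicModel
import Summits.BirchSwinnertonDyer.BirchSwinnertonDyer.Theorems.ManinLocalTwoThreeManinOddAtFourEtaTwoMinimalTwist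
import HarnessLib

/-!
# Route `ThetaPartnerAtTwo` (TP2), crux K3 `SignedKatoDivisibilityUpToAtTwo` (item stmt-BirchSwinnertonDyer-20308),
# line `colemanrat` v3 — THE LOCAL THEORY AT `p = 2`, file 6: the good supersingular `ℤ₂`-MODEL in K3's own binders
# (`W` globally minimal, `GoodSS W 2`, `a₂(W) = 0`) and Kobayashi §8.4/8.7 for `W` at `2` with NO model hypothesis

HONEST FRAMING (cell `bsd-wall`, lead `bsd-wall-tp2-p2x` g2): THEOREMS ONLY — no definition, no named fact, no
instance, no `sorry`; nothing about any Selmer group is asserted; closes no item; BSD is NOT proved by any of this.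

## Why this file

Files 1–5 of the series are stated for a `ℤ₂`-model `M` with elliptic generic/special fibre, `2 ∣ a₁(M)` and
`tr(M ⊗ 𝔽₂) = 0`. K3 quantifies over `W/ℚ` globally minimal with `GoodSS W 2` (good reduction at `2`, `2 ∣ a₂(W)`) and
`W.frobeniusTrace 2 = 0`. This file supplies the model `M_W := integralModelInt W ⊗ ℤ₂` with all five properties — the
`p = 2` twin of the tree's `exists_goodSupersingularPadicModel` (odd `p`, via the Hasse coefficient; at `p = 2` the
supersingularity of the reduction is read off `a₁`: in characteristic `2` a nonsingular cubic with `a₁ = 1` has the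
rational `2`-torsion point `(a₃, ·)`, so `#Ẽ(𝔽₂)` is even and `a₂ = 3 − #Ẽ(𝔽₂)` is odd) — and restates Prop. 8.7 /
the tower points for `W` itself.

## What is proved

* §1 characteristic `2`: `even_a₁_of_hasGoodReductionAtPrime_two_of_even_frobeniusTrace_two` (`W` globally minimal, good at
  `2`, `a₂(W)` even ⟹ `a₁` even; the tree's `even_reductionPointCount_two_of_odd_a₁` + `a₂ = 3 − #W̃(𝔽₂)`) — the
  `frobeniusTrace` twin of the tree's `even_a₁_of_hasGoodReductionAtPrime_two_of_even_LFunction_two`.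
* §2 the model `M_W = (integralModelInt W).map (Int.castRingHom ℤ₂)` of a globally minimal `W` with `GoodSS W 2`:
  `isUnit_Δ_twoAdicModel`, `isElliptic_coe_twoAdicModel`, `isElliptic_toZMod_twoAdicModel`, `a₁_twoAdicModel_mem`
  (`a₁ ∈ 2ℤ₂`), `tr_twoAdicModel` (`tr(M_W ⊗ 𝔽₂) = a₂(W)`), `baseChange_twoAdicModel` (`M_W ⊗ ℚ̄₂ = W ⊗ ℚ̄₂`).
* §3 Kobayashi at `2` for `W`: `eq_zero_of_two_pow_smul_eq_zero_layer_of_goodSS` (Prop. 8.7: no `2`-power torsion in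
  `W(ℚ₂(ζ_{2^m}))` for EVERY `m`, `W` globally minimal with `GoodSS W 2`), `exists_towerPoints_of_goodSS` (the points
  `c_m` with `Λ(c_m) = ℓ_m` for `W` with `GoodSS W 2`, `a₂(W) = 0`).

References: [Kobayashi2003] §8.4, Prop. 8.7; [SilvermanAEC2009] III.2.3, V.4, VII.5 Prop. 5.1(a), Exercises 5.7, 5.10(a);
[KuriharaOtsuki2006] Prop. 1.1.
-/

set_option autoImplicit false
-- the Theorems namespace of this sub repeats the summit name by design (D-0017 nested layout)
set_option linter.dupNamespace false

noncomputable section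

open scoped Classical Topology NNReal
open Filter PowerSeries Finset

namespace Summit.BirchSwinnertonDyer.BirchSwinnertonDyer.Theorems

namespace SignedKatoOffTwo.LocalTwo

open Literature.RingTheory.FormalGroups WeierstrassCurve Field
open Summit.BirchSwinnertonDyer.Rank1Residual.Additive
open Summit.BirchSwinnertonDyer.Rank1Residual.Additive.PadicCyclotomicTower
open Summit.BirchSwinnertonDyer.Rank1Residual.Additive.BallEval
open Summit.BirchSwinnertonDyer.BirchSwinnertonDyer.Theorems.SignedKatoOffTwo.LocalAllPrimes
open Literature.NumberTheory.EllipticCurves Literature.NumberTheory.EllipticCurves.FormalGroupChart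
open Literature.NumberTheory.EllipticCurves.Rank1Residual

/-! ## §1 Characteristic `2`: `a₂(W)` even ⟹ `a₁` even -/

section CharTwo

variable (W : WeierstrassCurve ℚ) [W.IsGloballyMinimal]

/-- **Good reduction at `2` and `a₂(W)` even ⟹ `a₁` of the minimal equation is even** (i.e. `W mod 2` is
supersingular iff `ā₁ = 0`, the direction `ā₁ = 1 ⟹ a₂` odd): with `a₁` odd the reduction has an even number of
points (tree: `even_reductionPointCount_two_of_odd_a₁`), and `a₂ = 3 − #W̃(𝔽₂)` would be odd.
[cite: SilvermanAEC2009, V.4 (first paragraph) and Exercise 5.10(a)] -/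
theorem even_a₁_of_hasGoodReductionAtPrime_two_of_even_frobeniusTrace_two (hgood : W.HasGoodReductionAtPrime 2)
    (heven : Even (W.frobeniusTrace 2)) : Even (integralModelInt W).a₁ := by
  by_contra hodd
  rw [Int.not_even_iff_odd] at hodd
  obtain ⟨k, hk⟩ := even_reductionPointCount_two_of_odd_a₁ W hgood hodd
  have hodd' : Odd (W.frobeniusTrace 2) := by
    refine ⟨1 - (k : ℤ), ?_⟩
    rw [WeierstrassCurve.frobeniusTrace, hk]
    push_cast
    ring
  exact (Int.not_even_iff_odd.mpr hodd') heven

end CharTwo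

/-! ## §2 The good supersingular `ℤ₂`-model `M_W = integralModelInt W ⊗ ℤ₂` -/

section Model

variable (W : WeierstrassCurve ℚ) [W.IsGloballyMinimal]

/-- `Δ(M_W) ∈ ℤ₂ˣ` for `W` with good reduction at `2` (`2 ∤ Δ_min`). [cite: SilvermanAEC2009, VII.5 Prop. 5.1(a)] -/
theorem isUnit_Δ_twoAdicModel (hgood : W.HasGoodReductionAtPrime 2) :
    IsUnit ((integralModelInt W).map (Int.castRingHom ℤ_[2])).Δ := by
  have hΔ : ¬ ((2 : ℕ) : ℤ) ∣ minimalDiscriminantInt W :=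
    not_dvd_minimalDiscriminantInt_of_hasGoodReductionAtPrime' W 2 hgood
  rw [map_Δ, eq_intCast]
  exact Literature.NumberTheory.LFunctions.Wooley.isUnit_intCast_of_not_dvd hΔ

/-- The generic fibre `M_W ⊗ ℚ₂ = W ⊗ ℚ₂` is elliptic. [folklore] -/
theorem isElliptic_coe_twoAdicModel [W.IsElliptic] :
    (((integralModelInt W).map (Int.castRingHom ℤ_[2])).map PadicInt.Coe.ringHom).IsElliptic := by
  rw [map_coe_integralModelInt]; infer_instance

/-- The special fibre `M_W ⊗ 𝔽₂ = W̃` is elliptic for `W` with good reduction at `2`. [cite: SilvermanAEC2009, VII.5 Prop. 5.1(a)] -/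
theorem isElliptic_toZMod_twoAdicModel (hgood : W.HasGoodReductionAtPrime 2) :
    (((integralModelInt W).map (Int.castRingHom ℤ_[2])).map PadicInt.toZMod).IsElliptic := by
  rw [map_toZMod_integralModelInt]
  exact isElliptic_reduction_of_not_dvd (p := 2) W (not_dvd_minimalDiscriminantInt_of_hasGoodReductionAtPrime' W 2 hgood)

/-- **`a₁(M_W) ∈ 2ℤ₂`** for `W` globally minimal with `GoodSS W 2` (good reduction at `2` and `2 ∣ a₂(W)`): §1.
[cite: SilvermanAEC2009, V.4 and Exercise 5.10(a)] [cite: KuriharaOtsuki2006, Prop. 1.1 (p. 560)] -/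
theorem a₁_twoAdicModel_mem (hss : GoodSS W 2) :
    ((integralModelInt W).map (Int.castRingHom ℤ_[2])).a₁ ∈ IsLocalRing.maximalIdeal ℤ_[2] := by
  rw [map_a₁, eq_intCast]
  have heven : Even (integralModelInt W).a₁ :=
    even_a₁_of_hasGoodReductionAtPrime_two_of_even_frobeniusTrace_two W hss.1
      (even_iff_two_dvd.mpr (by exact_mod_cast hss.2))
  exact intCast_padicInt_mem_maximalIdeal_of_dvd (p := 2) (by exact_mod_cast even_iff_two_dvd.mp heven)

/-- **`tr(M_W ⊗ 𝔽₂) = a₂(W)`** (Manin's trace of the reduction is the tree's `frobeniusTrace`). [folklore] -/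
theorem tr_twoAdicModel (hgood : W.HasGoodReductionAtPrime 2) :
    Literature.NumberTheory.EllipticCurves.HasseManin.tr (((integralModelInt W).map (Int.castRingHom ℤ_[2])).map PadicInt.toZMod) =
      W.frobeniusTrace 2 := by
  haveI := isElliptic_toZMod_twoAdicModel W hgood
  exact tr_eq_frobeniusTrace W (map_toZMod_integralModelInt W)

/-- **`M_W ⊗ ℚ̄₂ = W ⊗ ℚ̄₂`.** [folklore] -/
theorem baseChange_twoAdicModel :
    ((integralModelInt W).map (Int.castRingHom ℤ_[2])).baseChange (AlgebraicClosure ℚ_[2]) =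
      W.baseChange (AlgebraicClosure ℚ_[2]) := by
  conv_rhs => rw [← map_integralModelInt W]
  rw [WeierstrassCurve.baseChange, WeierstrassCurve.baseChange, WeierstrassCurve.map_map, WeierstrassCurve.map_map]
  congr 1

end Model

/-! ## §3 Kobayashi at `2` for `W` itself -/

section Curve

variable (W : WeierstrassCurve ℚ) [W.IsGloballyMinimal]

/-- **Kobayashi's Prop. 8.7 AT `p = 2` in K3's binders**: for `W/ℚ` globally minimal with `GoodSS W 2`, a point of
`W(ℚ̄₂)` (read on the model `M_W`) with coordinates in `ℚ₂(ζ_{2^m})` killed by a power of `2` is `O` — EVERY layer `m`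
of the `2`-adic cyclotomic tower; NO model / torsion hypothesis left. [cite: Kobayashi2003, Prop. 8.7 (p. 16)] -/
theorem eq_zero_of_two_pow_smul_eq_zero_layer_of_goodSS (hss : GoodSS W 2) (m : ℕ)
    {Q : (genFibΩ 2 ((integralModelInt W).map (Int.castRingHom ℤ_[2]))).toAffine.Point}
    (hQ : Q ∈ subfieldPoints (genFibΩ 2 ((integralModelInt W).map (Int.castRingHom ℤ_[2]))) (layer 2 m).toSubfield
      coeffs_mem_layer) {k : ℕ} (hk : 2 ^ k • Q = 0) : Q = 0 := by
  haveI := isElliptic_toZMod_twoAdicModel W hss.1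
  exact eq_zero_of_two_pow_smul_eq_zero_of_mem_subfieldPoints_layer _ (a₁_twoAdicModel_mem W hss) m hQ hk

/-- **Kobayashi's points at `2` for `W` itself**: for `W/ℚ` globally minimal with `GoodSS W 2` and `a₂(W) = 0` there is a
family `c : ℕ → W(ℚ̄₂)` (on the model `M_W`) with `c_0 = O`, `c_m` rational over `ℚ₂(ζ_{2^m})`, `c_m ∈ Ŵ`, and
`Λ(c_m) = ℓ_m = ∑_{k<m}(−1)ᵏ(ζ_{2^{m−2k}} − 1)/2ᵏ`; these satisfy the generation step and the trace relations of file 5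
unconditionally (the integrality instance binder is discharged by `isIntegral_genFib_baseChange 2 _`). [cite: Kobayashi2003, §8.4, Lemma 8.9] [cite: KuriharaOtsuki2006, p. 557] -/
theorem exists_towerPoints_of_goodSS [W.IsElliptic]
    [hintΩ : (genFibΩ 2 ((integralModelInt W).map (Int.castRingHom ℤ_[2]))).IsIntegral (Valued.v (R := PadicAlgCl 2)).integer]
    (hss : GoodSS W 2) (ha : W.frobeniusTrace 2 = 0) :
    ∃ c : ℕ → (genFibΩ 2 ((integralModelInt W).map (Int.castRingHom ℤ_[2]))).toAffine.Point, c 0 = 0 ∧ ∀ m,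
      c m ∈ subfieldPoints (genFibΩ 2 ((integralModelInt W).map (Int.castRingHom ℤ_[2]))) (layer 2 m).toSubfield
        coeffs_mem_layer ∧
      c m ∈ kernel (Valued.v (R := PadicAlgCl 2)) (genFibΩ 2 ((integralModelInt W).map (Int.castRingHom ℤ_[2]))) ∧
      ptLogΩ 2 ((integralModelInt W).map (Int.castRingHom ℤ_[2])) (c m) = ell 2 m := by
  haveI := isElliptic_coe_twoAdicModel W
  haveI := isElliptic_toZMod_twoAdicModel W hss.1
  have htr : Literature.NumberTheory.EllipticCurves.HasseManin.tr
      (((integralModelInt W).map (Int.castRingHom ℤ_[2])).map PadicInt.toZMod) = 0 := by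
    rw [tr_twoAdicModel W hss.1, ha]
  exact exists_towerPoints 2 _ htr

end Curve

end SignedKatoOffTwo.LocalTwo

end Summit.BirchSwinnertonDyer.BirchSwinnertonDyer.Theorems

end
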